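import Summits.ResolutionOfSingularities.ResolutionOfSingularities.Theorems.FrobeniusClosingPatchingRelPerfectMonomialPolyhedraGameCharts
import HarnessLib

/-!
# Crux `PatchingRelPerfect` (stmt-ResolutionOfSingularities-16161), chain w52 — TargetsF3 (m) «M2-strong»,
# COMBINATORIAL HALF, Route F file F2: GOWARD'S PAIR MEASURE INSIDE THE FREE SET

[OURS · L1 W5.2 · background line; res-L1-w52-stub-4 g3 ROUTE-F memo §1 Phase A / FINAL, §2(a)(b), kernel form;
fact-free; nothing here is a statement of the manuscript under review]

Two generators `α, β` are `F`-COMPARABLE (`FComparable s F α β`) when they are comparable on the free part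
`S ∩ F` of every stratum `S`; equivalently (`fComparable_iff_badPairsF_eq_empty`) there is no `F`-internal BAD
INDEX PAIR `(g, g′)` (`g, g′ ∈ F`, `{g, g′}` a stratum, `α g > β g`, `α g′ < β g′`).  GOWARD'S STEP RESTRICTED TO
`F` (`exists_gowardF_step`): if a bad pair exists, blowing up a well-chosen bad pair `{g, g′} ⊆ F` (a legal centre in
the free game) makes the measure `(maxValF, numMaxF)` of `(α, β)` drop lexicographically — the new index pairs through
the exceptional index have value `< maxValF` because the partner `g′` was chosen with `β g′ − α g′` maximal
(g2's `exists_step_explicit`, scheme side p500388, transplanted to the game) — and the set of `F`-internal bad pairs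
of the moved state evolves AUTONOMOUSLY (it only sees old `F`-internal pairs).  Persistence of `F`-comparability
under moves is the sequel `…MonomialPolyhedraGamePersistence.lean`.

## References

* R. Goward, *A simple algorithm for principalization of monomial ideals*, Trans. AMS 357 (2005), §2. [Goward2005]
* J. Kollár, *Lectures on Resolution of Singularities* (2007), (3.111) Step 3. [Kollar2007]
-/

-- `Summit.<Summit>.<Sub>.Theorems` with `Sub = Summit` (single-conjunct summit, D-0017)
set_option linter.dupNamespace false

namespace Summit.ResolutionOfSingularities.ResolutionOfSingularities.Theorems

namespace PolyhedraGame

open Finset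

/-! ## `F`-comparability and `F`-internal bad index pairs -/

section BadPairs

variable (s : State) (F : Finset ℕ) (α β : ℕ →₀ ℕ)

/-- [OURS · W5.2 Route F] `α, β` are comparable on the free part of every stratum. -/
def FComparable : Prop := ∀ S ∈ s.Str, ComparableOn (S ∩ F) α β

/-- [OURS · W5.2 Route F] The `F`-internal BAD INDEX PAIRS of `(α, β)`: pairs `(g, g′)` of free indices spanning a
stratum with `α g > β g` and `α g′ < β g′`. -/
noncomputable def badPairsF : Finset (ℕ × ℕ) := by
  classical exact (F ×ˢ F).filter fun p => ({p.1, p.2} : Finset ℕ) ∈ s.Str ∧ β p.1 < α p.1 ∧ α p.2 < β p.2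

/-- [OURS · W5.2 Route F] The VALUE of an index pair: the larger of the two exponent gaps. [cite: Goward2005, §2] -/
def valueF (p : ℕ × ℕ) : ℕ := max (α p.1 - β p.1) (β p.2 - α p.2)

/-- [OURS · W5.2 Route F] The maximal value of a bad pair (`0` if none). -/
noncomputable def maxValF : ℕ := (badPairsF s F α β).sup (valueF α β)

/-- [OURS · W5.2 Route F] The number of bad pairs of maximal value. -/
noncomputable def numMaxF : ℕ := by
  classical exact ((badPairsF s F α β).filter fun p => valueF α β p = maxValF s F α β).card

variable {s F α β}

/-- [OURS] Membership in `badPairsF`. -/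
theorem mem_badPairsF_iff {p : ℕ × ℕ} :
    p ∈ badPairsF s F α β ↔
      p.1 ∈ F ∧ p.2 ∈ F ∧ ({p.1, p.2} : Finset ℕ) ∈ s.Str ∧ β p.1 < α p.1 ∧ α p.2 < β p.2 := by
  classical
  simp only [badPairsF, Finset.mem_filter, Finset.mem_product, and_assoc]

/-- [OURS] **`F`-comparability is the absence of `F`-internal bad pairs.** -/
theorem fComparable_iff_badPairsF_eq_empty (hs : s.WF) :
    FComparable s F α β ↔ badPairsF s F α β = ∅ := by
  constructor
  · intro h
    rw [Finset.eq_empty_iff_forall_notMem]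
    rintro ⟨g, g'⟩ hp
    obtain ⟨hg, hg', hstr, h1, h2⟩ := mem_badPairsF_iff.mp hp
    simp only at hg hg' hstr h1 h2
    rcases h _ hstr with hle | hle
    · have := hle g (Finset.mem_inter.mpr ⟨by simp, hg⟩); omega
    · have := hle g' (Finset.mem_inter.mpr ⟨by simp, hg'⟩); omega
  · intro h S hS
    by_contra hnc
    obtain ⟨k, hk, l, hl, hk', hl'⟩ := not_comparableOn_iff.mp hnc
    have hkl : ({k, l} : Finset ℕ) ∈ s.Str :=
      hs.str_down S hS _ (Finset.insert_subset (Finset.mem_inter.mp hk).1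
        (Finset.singleton_subset_iff.mpr (Finset.mem_inter.mp hl).1))
    have : (k, l) ∈ badPairsF s F α β :=
      mem_badPairsF_iff.mpr ⟨(Finset.mem_inter.mp hk).2, (Finset.mem_inter.mp hl).2, hkl, hk', hl'⟩
    rw [h] at this
    exact Finset.notMem_empty _ this

/-- [OURS] The value of a bad pair is at most the maximal value. -/
theorem valueF_le_maxValF {p : ℕ × ℕ} (hp : p ∈ badPairsF s F α β) : valueF α β p ≤ maxValF s F α β :=
  Finset.le_sup (f := valueF α β) hp

/-- [OURS] The two indices of a bad pair differ. -/
theorem ne_of_mem_badPairsF {p : ℕ × ℕ} (hp : p ∈ badPairsF s F α β) : p.1 ≠ p.2 := by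
  obtain ⟨-, -, -, h1, h2⟩ := mem_badPairsF_iff.mp hp
  intro h; rw [h] at h1; omega

/-- [OURS] Swapping the generators swaps the bad pairs. -/
theorem mem_badPairsF_swap_iff {p : ℕ × ℕ} : p.swap ∈ badPairsF s F β α ↔ p ∈ badPairsF s F α β := by
  rw [mem_badPairsF_iff, mem_badPairsF_iff]
  simp only [Prod.fst_swap, Prod.snd_swap, Finset.pair_comm]
  tauto

/-- [OURS] Swapping the generators maps the bad pairs bijectively. -/
theorem badPairsF_swap : badPairsF s F β α = (badPairsF s F α β).image Prod.swap := by
  ext p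
  rw [Finset.mem_image]
  constructor
  · intro hp
    exact ⟨p.swap, mem_badPairsF_swap_iff.mp (by simpa using hp), Prod.swap_swap p⟩
  · rintro ⟨q, hq, rfl⟩
    exact mem_badPairsF_swap_iff.mpr hq

/-- [OURS] The value is symmetric under the swap. -/
theorem valueF_swap (p : ℕ × ℕ) : valueF β α p.swap = valueF α β p := by
  simp only [valueF, Prod.fst_swap, Prod.snd_swap, max_comm]

/-- [OURS] The maximal value is symmetric. -/
theorem maxValF_swap : maxValF s F β α = maxValF s F α β := by
  rw [maxValF, maxValF, badPairsF_swap, Finset.sup_image]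
  exact Finset.sup_congr rfl fun p _ => valueF_swap p

/-- [OURS] The number of maximal bad pairs is symmetric. -/
theorem numMaxF_swap : numMaxF s F β α = numMaxF s F α β := by
  classical
  rw [numMaxF, numMaxF, badPairsF_swap, maxValF_swap, Finset.filter_image,
    Finset.card_image_of_injective _ Prod.swap_injective]
  congr 1
  exact Finset.filter_congr fun p _ => by
    show valueF β α p.swap = maxValF s F α β ↔ valueF α β p = maxValF s F α β
    rw [valueF_swap]

end BadPairs

/-! ## Goward's step inside `F` -/

section Step

variable {s : State} {F : Finset ℕ} {α β : ℕ →₀ ℕ} {g g' N : ℕ}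

/-- [OURS] The lexicographic order on the measure `(maxValF, numMaxF)`, spelled out. -/
def MeasureLt (s' : State) (F' : Finset ℕ) (α' β' : ℕ →₀ ℕ) (s : State) (F : Finset ℕ) (α β : ℕ →₀ ℕ) : Prop :=
  maxValF s' F' α' β' < maxValF s F α β ∨
    (maxValF s' F' α' β' = maxValF s F α β ∧ numMaxF s' F' α' β' < numMaxF s F α β)

/-- [OURS] The measure order is symmetric under swapping the generators on both sides. -/
theorem measureLt_swap_iff {s' : State} {F' : Finset ℕ} {α' β' : ℕ →₀ ℕ} :
    MeasureLt s' F' β' α' s F β α ↔ MeasureLt s' F' α' β' s F α β := by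
  simp only [MeasureLt, maxValF_swap, numMaxF_swap]

/-- [OURS] The exponent of a moved generator at the exceptional index of the pair centre `{g, g'}`. -/
theorem moveExp_pair_apply_new (hs : s.WF) (hN : N ∉ s.B) (hgg' : g ≠ g') {γ : ℕ →₀ ℕ} (hγ : γ ∈ s.A) :
    moveExp ({g, g'} : Finset ℕ) N 0 γ N = γ g + γ g' := by
  rw [moveExp_apply_self γ fun h => hN (hs.support_subset γ hγ h), Nat.sub_zero, weight, Finset.sum_pair hgg']

/-- [OURS] The exponent of a moved generator at an old index. -/
theorem moveExp_apply_of_mem_B (hN : N ∉ s.B) {J : Finset ℕ} {c : ℕ} (γ : ℕ →₀ ℕ) {i : ℕ} (hi : i ∈ s.B) :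
    moveExp J N c γ i = γ i :=
  moveExp_apply_of_ne γ fun h => hN (h ▸ hi)

/-- [OURS] **Classification of the bad pairs after Goward's step** (g2's `step_classify`, game side): with `g`
carrying the maximal gap `α g − β g = maxValF` and `g'` the partner of `g` with the largest opposite gap, after blowing
up `{g, g'}` (fresh `N`) every `F`-internal bad pair of the moved generators is either an OLD bad pair other than
`(g, g')` with the same value, or has value `< maxValF`. [cite: Goward2005, §2] -/
theorem badPairsF_move_classify (hs : s.WF) (hFB : F ⊆ s.B) (hN : N ∉ s.B) (hα : α ∈ s.A) (hβ : β ∈ s.A)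
    (hgg' : (g, g') ∈ badPairsF s F α β) (hgM : α g - β g = maxValF s F α β)
    (hg'max : ∀ L, (g, L) ∈ badPairsF s F α β → β L - α L ≤ β g' - α g')
    {p' : ℕ × ℕ}
    (hp' : p' ∈ badPairsF (move s {g, g'} N 0) (insert N F) (moveExp {g, g'} N 0 α) (moveExp {g, g'} N 0 β)) :
    (p' ∈ badPairsF s F α β ∧ p' ≠ (g, g') ∧
        valueF (moveExp {g, g'} N 0 α) (moveExp {g, g'} N 0 β) p' = valueF α β p') ∨
      valueF (moveExp {g, g'} N 0 α) (moveExp {g, g'} N 0 β) p' < maxValF s F α β := by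
  obtain ⟨hgF, hg'F, hJstr, hg1, hg2⟩ := mem_badPairsF_iff.mp hgg'
  simp only at hgF hg'F hJstr hg1 hg2
  have hne : g ≠ g' := ne_of_mem_badPairsF hgg'
  have hd_le : β g' - α g' ≤ maxValF s F α β :=
    (le_max_right _ _).trans (valueF_le_maxValF hgg')
  -- values at the new index
  have hαN : moveExp ({g, g'} : Finset ℕ) N 0 α N = α g + α g' := moveExp_pair_apply_new hs hN hne hα
  have hβN : moveExp ({g, g'} : Finset ℕ) N 0 β N = β g + β g' := moveExp_pair_apply_new hs hN hne hβ
  obtain ⟨K', L'⟩ := p'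
  obtain ⟨hK'F, hL'F, hstr', h1', h2'⟩ := mem_badPairsF_iff.mp hp'
  simp only at hK'F hL'F hstr' h1' h2'
  by_cases hK'N : K' = N
  · subst hK'N
    -- then `L' ≠ K'` and `L'` is an old free index
    have hL'N : L' ≠ K' := by rintro rfl; omega
    have hL'F' : L' ∈ F := (Finset.mem_insert.mp hL'F).resolve_left hL'N
    have hL'B : L' ∈ s.B := hFB hL'F'
    rw [hαN, hβN] at h1'
    rw [moveExp_apply_of_mem_B hN α hL'B, moveExp_apply_of_mem_B hN β hL'B] at h2'
    -- `{g, L'}` is an old stratum: the new stratum `{K', L'}` lies over `T₀ ∪ {g, g'}` with `L' ∈ T₀`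
    have hgL'str : ({g, L'} : Finset ℕ) ∈ s.Str := by
      rcases mem_moveStrata_iff.mp hstr' with ⟨hold, -⟩ | ⟨T₀, -, -, hT₀J, hins⟩
      · exact absurd (hs.str_subset _ hold (Finset.mem_insert_self _ _)) hN
      · have hL'T₀ : L' ∈ T₀ := by
          have : L' ∈ insert K' T₀ := hins.symm ▸ (by simp : L' ∈ ({K', L'} : Finset ℕ))
          exact (Finset.mem_insert.mp this).resolve_left hL'N
        refine hs.str_down _ hT₀J _ (Finset.insert_subset ?_ (Finset.singleton_subset_iff.mpr ?_))
        · exact Finset.mem_union_right _ (Finset.mem_insert_self _ _)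
        · exact Finset.mem_union_left _ hL'T₀
    have hgL' : (g, L') ∈ badPairsF s F α β := mem_badPairsF_iff.mpr ⟨hgF, hL'F', hgL'str, hg1, h2'⟩
    have hL'le := hg'max L' hgL'
    right
    rw [valueF]
    simp only
    rw [hαN, hβN, moveExp_apply_of_mem_B hN α hL'B, moveExp_apply_of_mem_B hN β hL'B]
    omega
  · have hK'F' : K' ∈ F := (Finset.mem_insert.mp hK'F).resolve_left hK'N
    have hK'B : K' ∈ s.B := hFB hK'F'
    rw [moveExp_apply_of_mem_B hN α hK'B, moveExp_apply_of_mem_B hN β hK'B] at h1'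
    by_cases hL'N : L' = N
    · -- impossible: it would force `maxValF < β g' − α g'`
      subst hL'N
      rw [hαN, hβN] at h2'
      omega
    · have hL'F' : L' ∈ F := (Finset.mem_insert.mp hL'F).resolve_left hL'N
      have hL'B : L' ∈ s.B := hFB hL'F'
      rw [moveExp_apply_of_mem_B hN α hL'B, moveExp_apply_of_mem_B hN β hL'B] at h2'
      have hKLN : N ∉ ({K', L'} : Finset ℕ) := by
        simp only [Finset.mem_insert, Finset.mem_singleton, not_or]
        exact ⟨fun h => hK'N h.symm, fun h => hL'N h.symm⟩
      obtain ⟨hold, hJKL⟩ := mem_str_of_mem_move_str_of_not_mem hstr' hKLN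
      left
      refine ⟨mem_badPairsF_iff.mpr ⟨hK'F', hL'F', hold, h1', h2'⟩, fun h => hJKL ?_, ?_⟩
      · simp only [Prod.mk.injEq] at h
        rw [h.1, h.2]
      · rw [valueF, valueF]
        simp only
        rw [moveExp_apply_of_mem_B hN α hK'B, moveExp_apply_of_mem_B hN β hK'B,
          moveExp_apply_of_mem_B hN α hL'B, moveExp_apply_of_mem_B hN β hL'B]

/-- [OURS] **The measure drops after Goward's step.** [cite: Goward2005, §2] -/
theorem measureLt_gowardF_step (hs : s.WF) (hFB : F ⊆ s.B) (hN : N ∉ s.B) (hα : α ∈ s.A) (hβ : β ∈ s.A)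
    (hgg' : (g, g') ∈ badPairsF s F α β) (hgM : α g - β g = maxValF s F α β)
    (hg'max : ∀ L, (g, L) ∈ badPairsF s F α β → β L - α L ≤ β g' - α g') :
    MeasureLt (move s {g, g'} N 0) (insert N F) (moveExp {g, g'} N 0 α) (moveExp {g, g'} N 0 β) s F α β := by
  classical
  set s' := move s {g, g'} N 0 with hs'
  set α' := moveExp ({g, g'} : Finset ℕ) N 0 α with hα'
  set β' := moveExp ({g, g'} : Finset ℕ) N 0 β with hβ'
  have hcl := fun p' hp' => badPairsF_move_classify (N := N) hs hFB hN hα hβ hgg' hgM hg'max (p' := p') hp'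
  have hle : maxValF s' (insert N F) α' β' ≤ maxValF s F α β := by
    refine Finset.sup_le fun p' hp' => ?_
    rcases hcl p' hp' with ⟨hp, -, hv⟩ | h
    · rw [hv]; exact valueF_le_maxValF hp
    · exact h.le
  rcases hle.lt_or_eq with hlt | heq
  · exact Or.inl hlt
  · refine Or.inr ⟨heq, ?_⟩
    have hvalgg' : valueF α β (g, g') = maxValF s F α β := by
      refine le_antisymm (valueF_le_maxValF hgg') ?_
      rw [valueF, ← hgM]; exact le_max_left _ _
    rw [numMaxF, numMaxF]
    refine Finset.card_lt_card ⟨fun p' hp' => ?_, fun hsub => ?_⟩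
    · obtain ⟨hp'bad, hp'v⟩ := Finset.mem_filter.mp hp'
      rcases hcl p' hp'bad with ⟨hp, -, hv⟩ | h
      · exact Finset.mem_filter.mpr ⟨hp, by rw [← hv, hp'v, heq]⟩
      · rw [hp'v, heq] at h; exact absurd h (lt_irrefl _)
    · have hmem : (g, g') ∈ (badPairsF s F α β).filter fun p => valueF α β p = maxValF s F α β :=
        Finset.mem_filter.mpr ⟨hgg', hvalgg'⟩
      obtain ⟨hbad', -⟩ := Finset.mem_filter.mp (hsub hmem)
      rcases hcl _ hbad' with ⟨-, hne, -⟩ | h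
      · exact hne rfl
      · -- value of `(g, g')` in the moved state equals the old one (old indices), hence `= maxValF`
        have hgB : g ∈ s.B := hFB (mem_badPairsF_iff.mp hgg').1
        have hg'B : g' ∈ s.B := hFB (mem_badPairsF_iff.mp hgg').2.1
        rw [valueF] at h
        simp only at h
        rw [moveExp_apply_of_mem_B hN α hgB, moveExp_apply_of_mem_B hN β hgB,
          moveExp_apply_of_mem_B hN α hg'B, moveExp_apply_of_mem_B hN β hg'B, ← hgM] at h
        exact absurd h (not_lt.mpr (le_max_left _ _))

/-- [OURS] Goward's step when some bad pair realises the maximal value by its FIRST gap. -/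
theorem exists_gowardF_step_of_fst (hs : s.WF) (hFB : F ⊆ s.B) (hα : α ∈ s.A) (hβ : β ∈ s.A)
    (hex : ∃ p ∈ badPairsF s F α β, α p.1 - β p.1 = maxValF s F α β) :
    ∃ g ∈ F, ∃ g' ∈ F, g ≠ g' ∧ ({g, g'} : Finset ℕ) ∈ s.Str ∧ ∀ N, N ∉ s.B →
      MeasureLt (move s {g, g'} N 0) (insert N F) (moveExp {g, g'} N 0 α) (moveExp {g, g'} N 0 β) s F α β := by
  classical
  obtain ⟨p₀, hp₀, hp₀M⟩ := hex
  set g := p₀.1 with hgdef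
  set partners := (badPairsF s F α β).filter fun p => p.1 = g with hpartners
  have hne : partners.Nonempty := ⟨p₀, Finset.mem_filter.mpr ⟨hp₀, rfl⟩⟩
  obtain ⟨p₁, hp₁, hp₁max⟩ := Finset.exists_max_image partners (fun p => β p.2 - α p.2) hne
  obtain ⟨hp₁bad, hp₁g⟩ := Finset.mem_filter.mp hp₁
  set g' := p₁.2 with hg'def
  have hgg' : (g, g') ∈ badPairsF s F α β := by
    have : p₁ = (g, g') := Prod.ext hp₁g rfl
    rwa [this] at hp₁bad
  have hg'max : ∀ L, (g, L) ∈ badPairsF s F α β → β L - α L ≤ β g' - α g' :=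
    fun L hL => hp₁max (g, L) (Finset.mem_filter.mpr ⟨hL, rfl⟩)
  obtain ⟨hgF, hg'F, hstr, -, -⟩ := mem_badPairsF_iff.mp hgg'
  exact ⟨g, hgF, g', hg'F, ne_of_mem_badPairsF hgg', hstr, fun N hN =>
    measureLt_gowardF_step hs hFB hN hα hβ hgg' hp₀M hg'max⟩

/-- [OURS] **GOWARD'S STEP INSIDE `F`**: if `(α, β)` has an `F`-internal bad pair, some bad pair `{g, g'} ⊆ F` is a
stratum whose blow-up (any fresh name) makes the measure drop. [cite: Goward2005, §2] -/
theorem exists_gowardF_step (hs : s.WF) (hFB : F ⊆ s.B) (hα : α ∈ s.A) (hβ : β ∈ s.A)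
    (hne : (badPairsF s F α β).Nonempty) :
    ∃ g ∈ F, ∃ g' ∈ F, g ≠ g' ∧ ({g, g'} : Finset ℕ) ∈ s.Str ∧ ∀ N, N ∉ s.B →
      MeasureLt (move s {g, g'} N 0) (insert N F) (moveExp {g, g'} N 0 α) (moveExp {g, g'} N 0 β) s F α β := by
  classical
  by_cases hex : ∃ p ∈ badPairsF s F α β, α p.1 - β p.1 = maxValF s F α β
  · exact exists_gowardF_step_of_fst hs hFB hα hβ hex
  · -- the maximal value is realised by a second gap: swap the generators
    obtain ⟨p, hp, hpM⟩ := Finset.exists_mem_eq_sup (badPairsF s F α β) hne (valueF α β)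
    have hp2 : β p.2 - α p.2 = maxValF s F α β := by
      rw [maxValF, hpM, valueF]
      rcases le_total (α p.1 - β p.1) (β p.2 - α p.2) with h | h
      · exact (max_eq_right h).symm
      · exfalso
        exact hex ⟨p, hp, by rw [maxValF, hpM, valueF, max_eq_left h]⟩
    have hex' : ∃ q ∈ badPairsF s F β α, β q.1 - α q.1 = maxValF s F β α :=
      ⟨p.swap, mem_badPairsF_swap_iff.mpr hp, by rw [Prod.fst_swap, maxValF_swap, hp2]⟩
    obtain ⟨g, hg, g', hg', hne', hstr, hstep⟩ := exists_gowardF_step_of_fst hs hFB hβ hα hex'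
    exact ⟨g, hg, g', hg', hne', hstr, fun N hN => measureLt_swap_iff.mp (hstep N hN)⟩

end Step


end PolyhedraGame

end Summit.ResolutionOfSingularities.ResolutionOfSingularities.Theorems
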